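import Summits.HubbardSuperconductivity.HubbardSuperconductivity.Theses.AposterioriCapRg
import Literature.MathematicalPhysics.QuantumLattice.DWaveOrderParameterProofs

/-!
# Slope transfer down the dyadic staircase of the `d`-wave source
# (crux `AposterioriOrderCriterionR`, line `cauchy-griffiths-source-shells`, stub M3)

Pure bookkeeping step of the line, no physics. Write `E_L(t) = E₀(dWaveSourceTorus L U μ t)` for the
sourced ground-state energy, `m_L(t) = dWaveSourceDensity L U μ t` for the sourced pair density and
`S_L(h) = (E_L(h) - E_L(2h)) / h`. The tree's chord inequality
`dWaveSourceDensity_mul_le_groundEnergy_drop` gives `2L² m_L(h) ≤ S_L(h) ≤ 2L² m_L(2h)` for `h > 0`.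
A floor `m₁ ≤ liminf_L m_{L+1}(h₀)` at the TOP stair `h₀`, together with the dyadic second-difference
budget `S_{L+1}(h) - S_{L+1}(h/2) ≤ 2Φ(h)(L+1)²` at every stair `h ∈ (0, h₀]` (eventually in `L`) and
`Σ_{j ≤ J} Φ(h₀/2^j) ≤ Φtot` for all `J`, telescopes to `m_{L+1}(h₀) - Φtot ≤ m_{L+1}(h₀/2^J)`
eventually in `L`; hence the floor `m₁ - Φtot` holds on the inner liminf at every dyadic stair
`h₀/2^J`, at every stair in between (the stairs are monotone, `liminf_dWaveSourceDensity_mono`), and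
finally on the order parameter (`le_dWaveOrderParameter_of_forall`).

No definition is introduced. Sources: T. Koma, H. Tasaki, J. Stat. Phys. 76 (1994) 745, §1
[cite: KomaTasaki1994, §1] (order parameter under a symmetry-breaking source, `Λ ↑ ℤ²` before
`h ↓ 0`); the statements below are folklore consequences of the concavity of the sourced ground-state
energy (variational chord inequalities of `DWaveSourceProofs.lean`).
-/

noncomputable section

namespace Summit.HubbardSuperconductivity.HubbardSuperconductivity.Theorems

-- summit = problem name (single-conjunct summit), D-0017
set_option linter.dupNamespace false

open Literature.MathematicalPhysics.QuantumLattice Literature.Probability.LatticeModels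
open Filter Set

/-! ### Real-variable bookkeeping -/

/-- Telescoping a chain of one-step bounds: `S 0 - S (J+1) ≤ Σ_{j ≤ J} c j` whenever
`S j - S (j+1) ≤ c j` for `j ≤ J`. [folklore] -/
private theorem sub_le_sum_of_forall_sub_succ_le (S c : ℕ → ℝ) (J : ℕ)
    (H : ∀ j ∈ Finset.range (J + 1), S j - S (j + 1) ≤ c j) :
    S 0 - S (J + 1) ≤ ∑ j ∈ Finset.range (J + 1), c j := by
  rw [← Finset.sum_range_sub' S (J + 1)]
  exact Finset.sum_le_sum H

/-- Transfer of a floor along an eventual comparison of two bounded real sequences: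
`m ≤ liminf f`, `f - c ≤ g` eventually, `0 ≤ f`, `g ≤ B` give `m - c ≤ liminf g`. [folklore] -/
private theorem sub_le_liminf_of_eventually_sub_le {f g : ℕ → ℝ} {m c B : ℝ}
    (hm : m ≤ liminf f atTop) (hf : ∀ n, 0 ≤ f n) (hg : ∀ n, g n ≤ B)
    (hfg : ∀ᶠ n in atTop, f n - c ≤ g n) : m - c ≤ liminf g atTop := by
  refine le_of_forall_sub_le fun ε hε => ?_
  have hlt : m - ε < liminf f atTop := by linarith
  have hev : ∀ᶠ n in atTop, m - ε < f n :=
    eventually_lt_of_lt_liminf hlt (isBoundedUnder_of_eventually_ge (Eventually.of_forall hf))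
  refine le_liminf_of_le (isCoboundedUnder_ge_of_eventually_le _ (Eventually.of_forall hg)) ?_
  filter_upwards [hev, hfg] with n h1 h2
  linarith

/-- Dyadic stairs: `h₀ / 2^j ∈ (0, h₀]` for `h₀ > 0`. [folklore] -/
private theorem div_two_pow_mem_Ioc {h₀ : ℝ} (hh₀ : 0 < h₀) (j : ℕ) :
    h₀ / 2 ^ j ∈ Set.Ioc (0 : ℝ) h₀ :=
  ⟨by positivity, div_le_self hh₀.le (one_le_pow₀ (by norm_num))⟩

/-- Dyadic stairs reach below every positive level: for `0 < h` there is `J` with `h₀ / 2^J ≤ h`.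
[folklore] -/
private theorem exists_div_two_pow_le {h₀ h : ℝ} (hh₀ : 0 < h₀) (hh : 0 < h) :
    ∃ J : ℕ, h₀ / 2 ^ J ≤ h := by
  obtain ⟨J, hJ⟩ := exists_pow_lt_of_lt_one (div_pos hh hh₀) (by norm_num : (1 / 2 : ℝ) < 1)
  refine ⟨J, ?_⟩
  rw [lt_div_iff₀ hh₀] at hJ
  have : h₀ / 2 ^ J = (1 / 2) ^ J * h₀ := by
    rw [one_div, inv_pow, mul_comm, div_eq_mul_inv]
  rw [this]
  exact hJ.le

/-! ### One torus: chords and telescoping -/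

/-- **Chord + telescoping bookkeeping on one torus.** If at the stairs `h₀/2^j`, `j ≤ J`, the dyadic
second differences of `S_L(h) = (E_L(h) - E_L(2h))/h` are bounded by `2Φ(h₀/2^j)L²`, and
`Σ_{j ≤ J} Φ(h₀/2^j) ≤ Φtot`, then `m_L(h₀) - Φtot ≤ m_L(h₀/2^J)` (chords `2L²m(h) ≤ S(h) ≤ 2L²m(2h)`).
[folklore] -/
private theorem dWaveSourceDensity_sub_le_dyadic {L : ℕ} [NeZero L] (U μ : ℝ) {h₀ Φtot : ℝ}
    {Φ : ℝ → ℝ} (hh₀ : 0 < h₀) {J : ℕ} (hΦ : ∑ j ∈ Finset.range (J + 1), Φ (h₀ / 2 ^ j) ≤ Φtot)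
    (H : ∀ j ∈ Finset.range (J + 1),
      ((dWaveSourceTorus L U μ (h₀ / 2 ^ j)).groundEnergy -
          (dWaveSourceTorus L U μ (2 * (h₀ / 2 ^ j))).groundEnergy) / (h₀ / 2 ^ j) -
        ((dWaveSourceTorus L U μ (h₀ / 2 ^ j / 2)).groundEnergy -
          (dWaveSourceTorus L U μ (h₀ / 2 ^ j)).groundEnergy) / (h₀ / 2 ^ j / 2) ≤
        2 * Φ (h₀ / 2 ^ j) * (L : ℝ) ^ 2) :
    dWaveSourceDensity L U μ h₀ - Φtot ≤ dWaveSourceDensity L U μ (h₀ / 2 ^ J) := by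
  have hN := cast_sq_pos_of_neZero L
  -- the slopes at the dyadic stairs
  let S : ℕ → ℝ := fun j =>
    ((dWaveSourceTorus L U μ (h₀ / 2 ^ j)).groundEnergy -
      (dWaveSourceTorus L U μ (2 * (h₀ / 2 ^ j))).groundEnergy) / (h₀ / 2 ^ j)
  -- one-step bounds
  have hstep : ∀ j ∈ Finset.range (J + 1), S j - S (j + 1) ≤ 2 * Φ (h₀ / 2 ^ j) * (L : ℝ) ^ 2 := by
    intro j hj
    have e1 : h₀ / 2 ^ (j + 1) = h₀ / 2 ^ j / 2 := by rw [div_div, pow_succ]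
    have e2 : 2 * (h₀ / 2 ^ j / 2) = h₀ / 2 ^ j := by rw [two_mul, add_halves]
    simp only [S]
    rw [e1, e2]
    exact H j hj
  -- telescoping
  have htel : S 0 - S (J + 1) ≤ 2 * Φtot * (L : ℝ) ^ 2 := by
    refine (sub_le_sum_of_forall_sub_succ_le S _ J hstep).trans ?_
    rw [← Finset.sum_mul, ← Finset.mul_sum]
    exact mul_le_mul_of_nonneg_right (mul_le_mul_of_nonneg_left hΦ zero_le_two) hN.le
  -- lower chord at the top stair
  have hlow : 2 * (L : ℝ) ^ 2 * dWaveSourceDensity L U μ h₀ ≤ S 0 := by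
    have key := dWaveSourceDensity_mul_le_groundEnergy_drop (L := L) U μ h₀ (2 * h₀)
    show _ ≤ ((dWaveSourceTorus L U μ (h₀ / 2 ^ 0)).groundEnergy -
      (dWaveSourceTorus L U μ (2 * (h₀ / 2 ^ 0))).groundEnergy) / (h₀ / 2 ^ 0)
    rw [pow_zero, div_one, le_div_iff₀ hh₀]
    linarith
  -- upper chord at the bottom stair
  have hup : S (J + 1) ≤ 2 * (L : ℝ) ^ 2 * dWaveSourceDensity L U μ (h₀ / 2 ^ J) := by
    have ha : 0 < h₀ / 2 ^ (J + 1) := by positivity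
    have e3 : 2 * (h₀ / 2 ^ (J + 1)) = h₀ / 2 ^ J := by
      rw [pow_succ, ← div_div, two_mul, add_halves]
    have key := dWaveSourceDensity_mul_le_groundEnergy_drop (L := L) U μ (2 * (h₀ / 2 ^ (J + 1)))
      (h₀ / 2 ^ (J + 1))
    rw [← e3]
    show ((dWaveSourceTorus L U μ (h₀ / 2 ^ (J + 1))).groundEnergy -
      (dWaveSourceTorus L U μ (2 * (h₀ / 2 ^ (J + 1)))).groundEnergy) / (h₀ / 2 ^ (J + 1)) ≤ _
    rw [div_le_iff₀ ha]
    linarith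
  -- combine and divide by `2L² > 0`
  have h2N : (0 : ℝ) < 2 * (L : ℝ) ^ 2 := by positivity
  refine le_of_mul_le_mul_left ?_ h2N
  linarith [hlow, hup, htel]

/-! ### The sequence of tori: eventual bookkeeping and the liminf floor -/

/-- Eventually in `L`, the floor drops by at most `Φtot` from the top stair `h₀` to the dyadic stair
`h₀/2^J`: `m_{L+1}(h₀) - Φtot ≤ m_{L+1}(h₀/2^J)`. [folklore] -/
private theorem eventually_dWaveSourceDensity_sub_le_dyadic (U μ : ℝ) {h₀ Φtot : ℝ} {Φ : ℝ → ℝ}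
    (hh₀ : 0 < h₀) (hΦ : ∀ J : ℕ, ∑ j ∈ Finset.range (J + 1), Φ (h₀ / 2 ^ j) ≤ Φtot)
    (H : ∀ h ∈ Set.Ioc (0:ℝ) h₀, ∀ᶠ L : ℕ in atTop,
      ((dWaveSourceTorus (L + 1) U μ h).groundEnergy -
          (dWaveSourceTorus (L + 1) U μ (2 * h)).groundEnergy) / h -
        ((dWaveSourceTorus (L + 1) U μ (h / 2)).groundEnergy -
          (dWaveSourceTorus (L + 1) U μ h).groundEnergy) / (h / 2) ≤
        2 * Φ h * ((L + 1 : ℕ) : ℝ) ^ 2)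
    (J : ℕ) :
    ∀ᶠ L : ℕ in atTop, dWaveSourceDensity (L + 1) U μ h₀ - Φtot ≤
      dWaveSourceDensity (L + 1) U μ (h₀ / 2 ^ J) := by
  have hall := (Filter.eventually_all_finset (Finset.range (J + 1))).2
    fun j _ => H (h₀ / 2 ^ j) (div_two_pow_mem_Ioc hh₀ j)
  filter_upwards [hall] with L hL
  exact dWaveSourceDensity_sub_le_dyadic U μ hh₀ (hΦ J) hL

/-- **Slope transfer** (line cauchy-griffiths-source-shells, stub M3; pure bookkeeping). With
`E_L(t) = E₀(dWaveSourceTorus L U μ t)`: a floor `m₁ ≤ liminf_L dWaveSourceDensity (L+1) U μ h₀` at the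
top stair and, at every stair `h ∈ (0, h₀]`, eventually in `L`, the dyadic second-difference bound
`(E(h)−E(2h))/h − (E(h/2)−E(h))/(h/2) ≤ 2Φ(h)(L+1)²` with `Σ_{j≤J} Φ(h₀/2^j) ≤ Φtot` for all `J`, give
`m₁ − Φtot ≤ dWaveOrderParameter U μ` (chords `2m(h) ≤ A(h) ≤ 2m(2h)`, telescoping, monotone stairs,
`le_dWaveOrderParameter_of_forall`). [folklore] -/
theorem stub_slopeTransfer : ∀ (U μ h₀ m₁ Φtot : ℝ) (Φ : ℝ → ℝ), 0 < h₀ →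
    (∀ J : ℕ, ∑ j ∈ Finset.range (J + 1), Φ (h₀ / 2 ^ j) ≤ Φtot) →
    m₁ ≤ liminf (fun L : ℕ => dWaveSourceDensity (L + 1) U μ h₀) atTop →
    (∀ h ∈ Set.Ioc (0:ℝ) h₀, ∀ᶠ L : ℕ in atTop,
      ((dWaveSourceTorus (L + 1) U μ h).groundEnergy - (dWaveSourceTorus (L + 1) U μ (2 * h)).groundEnergy) / h -
        ((dWaveSourceTorus (L + 1) U μ (h / 2)).groundEnergy - (dWaveSourceTorus (L + 1) U μ h).groundEnergy) / (h / 2) ≤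
        2 * Φ h * ((L + 1 : ℕ) : ℝ) ^ 2) →
    m₁ - Φtot ≤ dWaveOrderParameter U μ := by
  intro U μ h₀ m₁ Φtot Φ hh₀ hΦ hm₁ H
  -- the floor on every dyadic stair `h₀ / 2^J`
  have hstair : ∀ J : ℕ, m₁ - Φtot ≤
      liminf (fun L : ℕ => dWaveSourceDensity (L + 1) U μ (h₀ / 2 ^ J)) atTop := fun J =>
    sub_le_liminf_of_eventually_sub_le hm₁ (fun L => dWaveSourceDensity_nonneg U μ hh₀.le)
      (fun L => dWaveSourceDensity_le_const (L + 1) U μ (h₀ / 2 ^ J))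
      (eventually_dWaveSourceDensity_sub_le_dyadic U μ hh₀ hΦ H J)
  -- monotone stairs fill the dyadic gaps; the lower lever closes
  refine le_dWaveOrderParameter_of_forall U μ hh₀ fun h hh => ?_
  obtain ⟨J, hJ⟩ := exists_div_two_pow_le hh₀ hh.1
  exact (hstair J).trans (liminf_dWaveSourceDensity_mono U μ (div_two_pow_mem_Ioc hh₀ J).1.le hJ)

end Summit.HubbardSuperconductivity.HubbardSuperconductivity.Theorems

end
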